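import Literature.MathematicalPhysics.QuantumFieldTheory.OSSkeletonPullback
import Mathlib.MeasureTheory.Measure.Lebesgue.EqHaar
import HarnessLib

/-!
# Quantitative frames near the time axis: dual bases, the inverse position map and the Jacobian (OS II, Ch. V.1/VI.1)

Topic `Literature/MathematicalPhysics/QuantumFieldTheory`; support file for the temperedness
estimate (4.5) of Osterwalder–Schrader II, Thm. 4.1 (the constants of the real-analyticity
construction must be powers of the configuration size and of the inverse minimal time gap). The
frames `ê_μ` of OS II p. 291 ((5.10)–(5.11)) are taken explicitly as the normalisations of
`e₀ + ε e_μ`; this file records their **explicit dual basis** and the resulting bounds: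

* `rawFrame ε μ = e₀ + ε e_μ`, `stdFrame ε μ = rawFrame/‖rawFrame‖`; `rawDual`, `stdDual` — the dual
  vectors `ε⁻¹ (e_ν − [ν = 0] (1+ε)⁻¹ 𝟙)` (Sherman–Morrison for `εI + e₀𝟙ᵀ`) and
  `inner_stdFrame_stdDual : ⟪ê_μ, ŵ_ν⟫ = δ_{μν}`; hence linear independence and
  `dualDir (stdFrame ε) = stdDual ε` (`dualDir_stdFrame`), with `‖ŵ_ν‖ ≤ 2(1 + √d)/ε`;
* `‖ê_μ‖ = 1`, `‖ê_μ − e₀‖ ≤ 2ε`, `⟪ê_μ, ê_ν⟫ ≥ 0` for small `ε`;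
* `norm_posLinCLE_symm_le` — **the inverse position map through the dual basis**:
  `‖posLin⁻¹ y‖ ≤ 2 √((k+2)d) · (max ‖dualDir‖) · ‖y‖` for any frame;
* `jacobian_le` — **the Jacobian constant of `posAff` through the inverse position map**, without
  determinants: if `∫ Φ(posAff U) dU = c ∫ Φ` for all `Φ`, then
  `c ≤ ‖posLin⁻¹‖^{(k+2)d} · vol(B₁)/vol(B₁')` (compare the volumes of the preimage of a unit ball
  and of a unit ball); `jacobian_ge`, `jacobian_ge'` — the lower bound
  `c ≥ ((k+2) ∑‖ê_μ‖)^{-(k+2)d} · vol(B₁)/vol(B₁')` through the forward bound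
  `‖posLin‖ ≤ (k+2) ∑‖ê_μ‖` (`opNorm_posLinCLE_le`).

## References

* K. Osterwalder, R. Schrader, *Axioms for Euclidean Green's functions II*, Comm. Math. Phys.
  42 (1975) 281–305, Ch. V.1 (5.6), (5.10)–(5.12); Thm. 4.1 (4.5). [OsterwalderSchraderCMP1975]
-/

noncomputable section

open MeasureTheory Set Filter Module Metric
open _root_.Topology
open scoped InnerProductSpace RealInnerProductSpace ENNReal

namespace Literature.MathematicalPhysics.QuantumFieldTheory

open OSFrames

variable {d : ℕ}

/-! ### Euclidean norms from coordinate bounds -/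

/-- `‖x‖ ≤ √(card ι) B` when all coordinates are at most `B` in absolute value. [folklore] -/
theorem EuclideanSpace.norm_le_sqrt_card_mul {ι : Type*} [Fintype ι] (x : EuclideanSpace ℝ ι) {B : ℝ} (hB : 0 ≤ B)
    (h : ∀ i, |x i| ≤ B) : ‖x‖ ≤ Real.sqrt (Fintype.card ι) * B := by
  rw [EuclideanSpace.norm_eq]
  have h1 : ∑ i, ‖x i‖ ^ 2 ≤ Fintype.card ι * B ^ 2 := by
    calc ∑ i, ‖x i‖ ^ 2 ≤ ∑ _i : ι, B ^ 2 := Finset.sum_le_sum fun i _ => by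
          rw [Real.norm_eq_abs]; exact pow_le_pow_left₀ (abs_nonneg _) (h i) 2
      _ = Fintype.card ι * B ^ 2 := by simp
  calc Real.sqrt (∑ i, ‖x i‖ ^ 2) ≤ Real.sqrt (Fintype.card ι * B ^ 2) := Real.sqrt_le_sqrt h1
    _ = Real.sqrt (Fintype.card ι) * B := by rw [Real.sqrt_mul (Nat.cast_nonneg _), Real.sqrt_sq hB]

/-! ### The standard frames and their dual bases -/

section StdFrame

variable [NeZero d]

/-- The raw frame `v_μ = e₀ + ε e_μ`. [cite: OsterwalderSchraderCMP1975, Ch. V.1 (5.10)–(5.11)] -/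
def rawFrame (ε : ℝ) (μ : Fin d) : EuclideanSpace ℝ (Fin d) := timeAxis + ε • EuclideanSpace.single μ (1 : ℝ)

/-- The all-ones vector `𝟙 = ∑_μ e_μ`. [folklore] -/
def onesVec (d : ℕ) : EuclideanSpace ℝ (Fin d) := ∑ μ, EuclideanSpace.single μ (1 : ℝ)

/-- The raw dual vectors `w_ν = ε⁻¹ (e_ν − [ν = 0] (1 + ε)⁻¹ 𝟙)` (Sherman–Morrison for `εI + e₀𝟙ᵀ`). [folklore] -/
def rawDual (ε : ℝ) (ν : Fin d) : EuclideanSpace ℝ (Fin d) :=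
  ε⁻¹ • (EuclideanSpace.single ν (1 : ℝ) - (if ν = 0 then (1 + ε)⁻¹ else 0) • onesVec d)

/-- **The standard frame** `ê_μ = v_μ / ‖v_μ‖`. [cite: OsterwalderSchraderCMP1975, Ch. V.1 (5.10)–(5.11)] -/
def stdFrame (ε : ℝ) (μ : Fin d) : EuclideanSpace ℝ (Fin d) := (‖rawFrame (d := d) ε μ‖)⁻¹ • rawFrame ε μ

/-- **The dual vectors of the standard frame** `ŵ_ν = ‖v_ν‖ w_ν`. [folklore] -/
def stdDual (ε : ℝ) (ν : Fin d) : EuclideanSpace ℝ (Fin d) := ‖rawFrame (d := d) ε ν‖ • rawDual ε ν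

omit [NeZero d] in
/-- Coordinates of `𝟙`. [folklore] -/
@[simp]
theorem onesVec_apply (i : Fin d) : onesVec d i = 1 := by
  simp [onesVec, WithLp.ofLp_sum, Finset.sum_apply]

omit [NeZero d] in
/-- `⟪e_i, 𝟙⟫ = 1`. [folklore] -/
theorem inner_single_onesVec (i : Fin d) : ⟪EuclideanSpace.single i (1 : ℝ), onesVec d⟫ = 1 := by
  rw [EuclideanSpace.inner_single_left, onesVec_apply, map_one, one_mul]

omit [NeZero d] in
/-- `‖𝟙‖ = √d`. [folklore] -/
theorem norm_onesVec : ‖onesVec d‖ = Real.sqrt d := by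
  rw [EuclideanSpace.norm_eq]
  simp

/-- The raw frame is at distance `|ε|` from the time axis. [folklore] -/
theorem norm_rawFrame_sub (ε : ℝ) (μ : Fin d) : ‖rawFrame (d := d) ε μ - timeAxis‖ = |ε| := by
  simp [rawFrame, norm_smul, PiLp.norm_single]

/-- `1 − |ε| ≤ ‖v_μ‖ ≤ 1 + |ε|`. [folklore] -/
theorem norm_rawFrame_bounds (ε : ℝ) (μ : Fin d) : 1 - |ε| ≤ ‖rawFrame (d := d) ε μ‖ ∧ ‖rawFrame (d := d) ε μ‖ ≤ 1 + |ε| := by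
  have h1 := norm_sub_norm_le (rawFrame (d := d) ε μ) timeAxis
  have h2 := norm_le_norm_add_norm_sub' (rawFrame (d := d) ε μ) timeAxis
  have h3 := norm_sub_norm_le (timeAxis : EuclideanSpace ℝ (Fin d)) (rawFrame ε μ)
  rw [norm_rawFrame_sub] at h1
  rw [norm_timeAxis] at h1 h3
  rw [norm_sub_rev, norm_rawFrame_sub] at h3
  constructor
  · linarith
  · have h4 : ‖rawFrame (d := d) ε μ‖ ≤ ‖(timeAxis : EuclideanSpace ℝ (Fin d))‖ + ‖rawFrame (d := d) ε μ - timeAxis‖ :=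
      norm_le_norm_add_norm_sub' _ _
    rw [norm_timeAxis, norm_rawFrame_sub] at h4
    exact h4

/-- **The pairing of the raw frame with the raw dual vectors is `δ`.** [folklore] -/
theorem inner_rawFrame_rawDual {ε : ℝ} (hε : ε ≠ 0) (hε1 : 1 + ε ≠ 0) (μ ν : Fin d) :
    ⟪rawFrame (d := d) ε μ, rawDual ε ν⟫ = if μ = ν then 1 else 0 := by
  have key : ⟪rawFrame (d := d) ε μ, rawDual ε ν⟫ =
      ε⁻¹ * ((if (0 : Fin d) = ν then 1 else 0) + ε * (if μ = ν then 1 else 0) -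
        (if ν = 0 then (1 + ε)⁻¹ else 0) * (1 + ε)) := by
    simp only [rawFrame, rawDual, timeAxis, inner_smul_right, inner_sub_right, inner_add_left, inner_smul_left,
      EuclideanSpace.inner_single_left, PiLp.single_apply, onesVec_apply, map_one, one_mul, conj_trivial]
    ring
  rw [key]
  by_cases hν : ν = 0
  · subst hν
    rw [if_pos rfl, if_pos rfl, inv_mul_cancel₀ hε1]
    by_cases hμ : μ = 0
    · subst hμ
      rw [if_pos rfl, mul_one, add_sub_cancel_left, inv_mul_cancel₀ hε]
    · rw [if_neg hμ]
      ring
  · rw [if_neg (Ne.symm hν), if_neg hν]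
    by_cases hμ : μ = ν
    · rw [if_pos hμ, zero_add, mul_one, zero_mul, sub_zero, inv_mul_cancel₀ hε]
    · rw [if_neg hμ]
      ring

/-- **The pairing of the standard frame with its dual vectors is `δ`.** [folklore] -/
theorem inner_stdFrame_stdDual {ε : ℝ} (hε : ε ≠ 0) (hε1 : 1 + ε ≠ 0) (hv : ∀ μ, rawFrame (d := d) ε μ ≠ 0) (μ ν : Fin d) :
    ⟪stdFrame (d := d) ε μ, stdDual ε ν⟫ = if μ = ν then 1 else 0 := by
  rw [stdFrame, stdDual, inner_smul_left, inner_smul_right, inner_rawFrame_rawDual hε hε1, conj_trivial]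
  by_cases hμ : μ = ν
  · subst hμ; rw [if_pos rfl, mul_one, inv_mul_cancel₀ (norm_ne_zero_iff.2 (hv μ))]
  · rw [if_neg hμ, mul_zero, mul_zero]

/-- For `|ε| < 1` the raw frame vectors are nonzero. [folklore] -/
theorem rawFrame_ne_zero {ε : ℝ} (hε : |ε| < 1) (μ : Fin d) : rawFrame (d := d) ε μ ≠ 0 := by
  intro h
  have h1 := (norm_rawFrame_bounds (d := d) ε μ).1
  rw [h, norm_zero] at h1
  linarith

/-- **The standard frame is linearly independent** (it has a dual family). [folklore] -/
theorem linearIndependent_stdFrame {ε : ℝ} (hε : ε ≠ 0) (hε1 : 1 + ε ≠ 0) (hε' : |ε| < 1) :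
    LinearIndependent ℝ (stdFrame (d := d) ε) := by
  refine Fintype.linearIndependent_iff.2 fun g hg ν => ?_
  have h := congrArg (fun w : EuclideanSpace ℝ (Fin d) => ⟪w, stdDual (d := d) ε ν⟫) hg
  simp only [sum_inner, inner_smul_left, conj_trivial, inner_zero_left,
    inner_stdFrame_stdDual hε hε1 (rawFrame_ne_zero hε'), mul_ite, mul_one, mul_zero,
    Finset.sum_ite_eq', Finset.mem_univ, if_true] at h
  exact h

/-- The standard frame consists of unit vectors. [folklore] -/
theorem norm_stdFrame {ε : ℝ} (hε' : |ε| < 1) (μ : Fin d) : ‖stdFrame (d := d) ε μ‖ = 1 := by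
  rw [stdFrame, norm_smul, norm_inv, norm_norm, inv_mul_cancel₀ (norm_ne_zero_iff.2 (rawFrame_ne_zero hε' μ))]

/-- **The standard frame is within `2|ε|` of the time axis.** [folklore] -/
theorem norm_stdFrame_sub_le {ε : ℝ} (hε' : |ε| < 1) (μ : Fin d) : ‖stdFrame (d := d) ε μ - timeAxis‖ ≤ 2 * |ε| := by
  have hv := rawFrame_ne_zero (d := d) hε' μ
  have hvn : 0 < ‖rawFrame (d := d) ε μ‖ := norm_pos_iff.2 hv
  have h1 : ‖stdFrame (d := d) ε μ - rawFrame ε μ‖ ≤ |ε| := by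
    rw [stdFrame, show (‖rawFrame (d := d) ε μ‖)⁻¹ • rawFrame (d := d) ε μ - rawFrame ε μ =
      ((‖rawFrame (d := d) ε μ‖)⁻¹ - 1) • rawFrame (d := d) ε μ by rw [sub_smul, one_smul], norm_smul, Real.norm_eq_abs]
    have h2 : |(‖rawFrame (d := d) ε μ‖)⁻¹ - 1| * ‖rawFrame (d := d) ε μ‖ = |1 - ‖rawFrame (d := d) ε μ‖| := by
      rw [show (‖rawFrame (d := d) ε μ‖)⁻¹ - 1 = (1 - ‖rawFrame (d := d) ε μ‖) * (‖rawFrame (d := d) ε μ‖)⁻¹ by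
        rw [sub_mul, one_mul, mul_inv_cancel₀ hvn.ne'], abs_mul, abs_inv, abs_norm, mul_assoc,
        inv_mul_cancel₀ hvn.ne', mul_one]
    rw [h2]
    have h3 := abs_norm_sub_norm_le (rawFrame (d := d) ε μ) timeAxis
    rw [norm_timeAxis, norm_rawFrame_sub, abs_sub_comm] at h3
    exact h3
  calc ‖stdFrame (d := d) ε μ - timeAxis‖ ≤ ‖stdFrame (d := d) ε μ - rawFrame ε μ‖ + ‖rawFrame (d := d) ε μ - timeAxis‖ :=
        norm_sub_le_norm_sub_add_norm_sub _ _ _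
    _ ≤ |ε| + |ε| := add_le_add h1 (norm_rawFrame_sub ε μ).le
    _ = 2 * |ε| := by ring

/-- For `|ε| < 1/4` the standard frame vectors see each other at nonnegative times. [folklore] -/
theorem inner_stdFrame_nonneg {ε : ℝ} (hε' : |ε| < 1 / 4) (μ ν : Fin d) : 0 ≤ ⟪stdFrame (d := d) ε μ, stdFrame ε ν⟫ := by
  have h1 : |ε| < 1 := by linarith
  have hn := fun ρ => (norm_stdFrame_sub_le (d := d) h1 ρ).trans_lt (by linarith : 2 * |ε| < 1 / 2)
  exact (inner_pos_of_near (hn μ) (hn ν) (norm_stdFrame h1 ν)).le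

/-- **Norm of the raw dual vectors**: `‖w_ν‖ ≤ |ε|⁻¹ (1 + |1+ε|⁻¹ √d)`. [folklore] -/
theorem norm_rawDual_le (ε : ℝ) (ν : Fin d) : ‖rawDual (d := d) ε ν‖ ≤ |ε|⁻¹ * (1 + |1 + ε|⁻¹ * Real.sqrt d) := by
  rw [rawDual, norm_smul, norm_inv, Real.norm_eq_abs]
  refine mul_le_mul_of_nonneg_left ((norm_sub_le _ _).trans (add_le_add (by rw [PiLp.norm_single, norm_one]) ?_))
    (by positivity)
  split_ifs
  · rw [norm_smul, norm_inv, Real.norm_eq_abs, norm_onesVec]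
  · rw [zero_smul, norm_zero]; positivity

/-- **Norm of the dual vectors of the standard frame**: `‖ŵ_ν‖ ≤ (1+|ε|) |ε|⁻¹ (1 + |1+ε|⁻¹ √d)`. [folklore] -/
theorem norm_stdDual_le (ε : ℝ) (ν : Fin d) :
    ‖stdDual (d := d) ε ν‖ ≤ (1 + |ε|) * (|ε|⁻¹ * (1 + |1 + ε|⁻¹ * Real.sqrt d)) := by
  rw [stdDual, norm_smul, norm_norm]
  exact mul_le_mul (norm_rawFrame_bounds ε ν).2 (norm_rawDual_le ε ν) (norm_nonneg _) (by positivity)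

/-- A convenient bound for `0 < ε ≤ 1`: `‖ŵ_ν‖ ≤ 2 (1 + √d) / ε`. [folklore] -/
theorem norm_stdDual_le' {ε : ℝ} (hε0 : 0 < ε) (hε1 : ε ≤ 1) (ν : Fin d) :
    ‖stdDual (d := d) ε ν‖ ≤ 2 * (1 + Real.sqrt d) / ε := by
  refine (norm_stdDual_le ε ν).trans ?_
  rw [abs_of_pos hε0, abs_of_pos (by linarith : 0 < 1 + ε)]
  have h1 : (1 + ε)⁻¹ * Real.sqrt d ≤ Real.sqrt d := by
    refine mul_le_of_le_one_left (Real.sqrt_nonneg _) ?_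
    rw [inv_le_one₀ (by linarith)]; linarith
  have h2 : 1 + ε ≤ 2 := by linarith
  rw [div_eq_mul_inv]
  have h3 : 0 ≤ ε⁻¹ := by positivity
  have h4 : (1 + ε) * (1 + (1 + ε)⁻¹ * Real.sqrt d) ≤ 2 * (1 + Real.sqrt d) :=
    mul_le_mul h2 (by linarith) (by positivity) (by norm_num)
  calc (1 + ε) * (ε⁻¹ * (1 + (1 + ε)⁻¹ * Real.sqrt d)) = ε⁻¹ * ((1 + ε) * (1 + (1 + ε)⁻¹ * Real.sqrt d)) := by ring
    _ ≤ ε⁻¹ * (2 * (1 + Real.sqrt d)) := mul_le_mul_of_nonneg_left h4 h3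
    _ = 2 * (1 + Real.sqrt d) * ε⁻¹ := by ring

/-- **The dual directions of the standard frame are its dual vectors**: `dualDir (stdFrame ε) = stdDual ε`. [folklore] -/
theorem dualDir_stdFrame {ε : ℝ} (hε : ε ≠ 0) (hε1 : 1 + ε ≠ 0) (hε' : |ε| < 1)
    (hli : LinearIndependent ℝ (stdFrame (d := d) ε)) (ν : Fin d) : dualDir (stdFrame ε) hli ν = stdDual ε ν := by
  refine ext_inner_left ℝ fun y => ?_
  rw [inner_dualDir]
  set B := dirBasis (stdFrame (d := d) ε) hli with hB
  conv_rhs => rw [← B.sum_repr y]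
  rw [sum_inner]
  simp only [inner_smul_left, conj_trivial, hB, coe_dirBasis, inner_stdFrame_stdDual hε hε1 (rawFrame_ne_zero hε'),
    mul_ite, mul_one, mul_zero, Finset.sum_ite_eq', Finset.mem_univ, if_true]

end StdFrame

/-! ### The inverse position map through the dual directions -/

section PosLin

variable [NeZero d] {k : ℕ} (ê : Fin d → EuclideanSpace ℝ (Fin d)) (hli : LinearIndependent ℝ ê)

/-- **The inverse position map through the dual directions**:
`‖posLin⁻¹ y‖ ≤ 2 √((k+2) d) D ‖y‖` when all `‖dualDir ν‖ ≤ D`. [folklore] -/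
theorem norm_posLinCLE_symm_le {D : ℝ} (hD : ∀ ν, ‖dualDir ê hli ν‖ ≤ D) (y : Fin (k + 2) → EuclideanSpace ℝ (Fin d)) :
    ‖(posLinCLE ê hli).symm y‖ ≤ 2 * Real.sqrt ((k + 2) * d) * D * ‖y‖ := by
  have hD0 : 0 ≤ D := (norm_nonneg _).trans (hD 0)
  set U := (posLinCLE ê hli).symm y with hU
  have hy : posLinCLE ê hli U = y := (posLinCLE ê hli).apply_symm_apply y
  have hrepr : ∀ (z : EuclideanSpace ℝ (Fin d)) ν, |(dirBasis ê hli).repr z ν| ≤ ‖z‖ * D := fun z ν => by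
    rw [← inner_dualDir]
    exact (abs_real_inner_le_norm _ _).trans (mul_le_mul_of_nonneg_left (hD ν) (norm_nonneg _))
  have hcoord : ∀ p : Fin (k + 2) × Fin d, |U p| ≤ 2 * D * ‖y‖ := by
    rintro ⟨j, ν⟩
    obtain ⟨h0, hsucc⟩ := coord_eq_repr_posLin ê hli U ν
    rw [hy] at h0 hsucc
    refine Fin.cases ?_ (fun i => ?_) j
    · rw [h0]
      refine (hrepr _ _).trans ?_
      nlinarith [norm_le_pi_norm y 0, norm_nonneg (y 0), norm_nonneg y]
    · rw [hsucc i]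
      refine (abs_sub _ _).trans ?_
      have h1 := (hrepr (y i.succ) ν).trans (mul_le_mul_of_nonneg_right (norm_le_pi_norm y _) hD0)
      have h2 := (hrepr (y (Fin.castSucc i)) ν).trans (mul_le_mul_of_nonneg_right (norm_le_pi_norm y _) hD0)
      linarith
  have h := EuclideanSpace.norm_le_sqrt_card_mul U (by positivity) hcoord
  rw [Fintype.card_prod, Fintype.card_fin, Fintype.card_fin] at h
  refine h.trans (le_of_eq ?_)
  push_cast
  ring

omit [NeZero d] in
/-- **The position map is bounded independently of the frame's conditioning**:
`‖posLin U‖ ≤ (k + 2) (∑_μ ‖ê_μ‖) ‖U‖`. [folklore] -/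
theorem norm_posLinCLE_le_sum (U : EuclideanSpace ℝ (Fin (k + 2) × Fin d)) :
    ‖posLinCLE ê hli U‖ ≤ (k + 2) * (∑ μ, ‖ê μ‖) * ‖U‖ := by
  have hE : 0 ≤ ∑ μ, ‖ê μ‖ := Finset.sum_nonneg fun μ _ => norm_nonneg _
  have hdir : ∀ c : Fin d → ℝ, (∀ μ, |c μ| ≤ ‖U‖) → ‖dirMap ê hli c‖ ≤ (∑ μ, ‖ê μ‖) * ‖U‖ := fun c hc => by
    rw [dirMap_apply]
    refine (norm_sum_le _ _).trans ?_
    rw [Finset.sum_mul]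
    refine Finset.sum_le_sum fun μ _ => ?_
    rw [norm_smul, Real.norm_eq_abs, mul_comm]
    exact mul_le_mul_of_nonneg_left (hc μ) (norm_nonneg _)
  have hcoord : ∀ p, |U p| ≤ ‖U‖ := fun p => by
    have h := PiLp.norm_apply_le U p
    rwa [Real.norm_eq_abs] at h
  refine (pi_norm_le_iff_of_nonneg (by positivity)).2 fun j => ?_
  rw [posLinCLE_apply, posLinEquiv_apply]
  refine (norm_add_le _ _).trans ?_
  have h1 := hdir (fun μ => U (0, μ)) fun μ => hcoord _
  have h2 : ‖∑ i ∈ Finset.univ.filter (fun i : Fin (k + 1) => i.val < j.val), dirMap ê hli fun μ => U (i.succ, μ)‖ ≤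
      (k + 1) * ((∑ μ, ‖ê μ‖) * ‖U‖) := by
    refine (norm_sum_le _ _).trans ?_
    calc ∑ i ∈ Finset.univ.filter (fun i : Fin (k + 1) => i.val < j.val), ‖dirMap ê hli fun μ => U (i.succ, μ)‖
        ≤ ∑ _i : Fin (k + 1), (∑ μ, ‖ê μ‖) * ‖U‖ :=
          (Finset.sum_le_sum_of_subset_of_nonneg (Finset.filter_subset _ _) fun i _ _ => norm_nonneg _).trans
            (Finset.sum_le_sum fun i _ => hdir _ fun μ => hcoord _)
      _ = (k + 1) * ((∑ μ, ‖ê μ‖) * ‖U‖) := by simp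
  have h3 : 0 ≤ (∑ μ, ‖ê μ‖) * ‖U‖ := by positivity
  linarith

omit [NeZero d] in
/-- The operator norm of the position map: `‖posLin‖ ≤ (k + 2) ∑_μ ‖ê_μ‖`. [folklore] -/
theorem opNorm_posLinCLE_le : ‖(posLinCLE (k := k) ê hli).toContinuousLinearMap‖ ≤ (k + 2) * ∑ μ, ‖ê μ‖ :=
  ContinuousLinearMap.opNorm_le_bound _ (by positivity) fun U => norm_posLinCLE_le_sum ê hli U

end PosLin

/-! ### The Jacobian constant of the affine position map -/

section Jacobian

variable [NeZero d] {k : ℕ} (ξ : Fin (k + 1) → EuclideanSpace ℝ (Fin d)) (ê : Fin d → EuclideanSpace ℝ (Fin d))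
  (hli : LinearIndependent ℝ ê)

omit [NeZero d] in
/-- The ratio of the volumes of the unit balls of the parameter space and of the configuration space
(a positive constant depending on `k` and `d` only). [folklore] -/
def jacobianRatio (k d : ℕ) : ℝ :=
  (volume (Metric.ball (0 : EuclideanSpace ℝ (Fin (k + 2) × Fin d)) 1)).toReal /
    (volume (Metric.ball (0 : Fin (k + 2) → EuclideanSpace ℝ (Fin d)) 1)).toReal

/-- **The Jacobian constant through the inverse position map** (no determinants): if
`∫ Φ(posAff U) dU = c ∫ Φ` for all `Φ`, then `c ≤ ‖posLin⁻¹‖^{(k+2)d} · jacobianRatio` (compare the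
volume of the preimage of the unit ball about `pbase`, contained in the ball of radius `‖posLin⁻¹‖`,
with the volume of the unit ball). [folklore] -/
theorem jacobian_le {c : ℝ}
    (hc : ∀ Φ : (Fin (k + 2) → EuclideanSpace ℝ (Fin d)) → ℂ, ∫ U, Φ (posAff ξ ê hli U) = (c : ℂ) * ∫ y, Φ y) :
    c ≤ ‖((posLinCLE (k := k) ê hli).symm).toContinuousLinearMap‖ ^ (Fintype.card (Fin (k + 2) × Fin d)) * jacobianRatio k d := by
  set L : ℝ := ‖((posLinCLE (k := k) ê hli).symm).toContinuousLinearMap‖ with hLdef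
  have hL : 0 < L := (posLinCLE (k := k) ê hli).symm.norm_pos
  set pre : Set (EuclideanSpace ℝ (Fin (k + 2) × Fin d)) := (posAff ξ ê hli) ⁻¹' Metric.ball (pbase ξ) 1 with hpre
  have hpre_sub : pre ⊆ Metric.ball 0 L := fun U hU => by
    rw [hpre, mem_preimage, mem_ball, dist_eq_norm, posAff, add_sub_cancel_left] at hU
    rw [mem_ball, dist_zero_right]
    calc ‖U‖ = ‖(posLinCLE ê hli).symm (posLinCLE ê hli U)‖ := by rw [ContinuousLinearEquiv.symm_apply_apply]
      _ ≤ L * ‖posLinCLE ê hli U‖ := ((posLinCLE ê hli).symm).toContinuousLinearMap.le_opNorm _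
      _ < L := mul_lt_of_lt_one_right hL hU
  have hpre_meas : MeasurableSet pre := (isOpen_ball.preimage (continuous_posAff ξ ê hli)).measurableSet
  -- the identity with the indicator of the unit ball about `pbase`
  have h := hc ((Metric.ball (pbase ξ) 1).indicator fun _ => (1 : ℂ))
  have hL1 : (fun U => (Metric.ball (pbase ξ) 1).indicator (fun _ => (1 : ℂ)) (posAff ξ ê hli U)) = pre.indicator fun _ => (1 : ℂ) := by
    funext U; rfl
  rw [hL1, integral_indicator_const _ hpre_meas, integral_indicator_const _ measurableSet_ball] at h
  simp only [Measure.real, Complex.real_smul, mul_one] at h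
  rw [Measure.addHaar_ball_center] at h
  -- volumes
  set vV : ℝ := (volume (Metric.ball (0 : EuclideanSpace ℝ (Fin (k + 2) × Fin d)) 1)).toReal with hvV
  set vC : ℝ := (volume (Metric.ball (0 : Fin (k + 2) → EuclideanSpace ℝ (Fin d)) 1)).toReal with hvC
  have hvol_cfg : 0 < vC := ENNReal.toReal_pos (measure_ball_pos volume _ one_pos).ne' measure_ball_lt_top.ne
  have hvol_pre : (volume pre).toReal ≤ L ^ Fintype.card (Fin (k + 2) × Fin d) * vV := by
    have h1 := measure_mono (μ := volume) hpre_sub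
    rw [Measure.addHaar_ball_of_pos volume _ hL, finrank_euclideanSpace] at h1
    have h2 := ENNReal.toReal_mono (ENNReal.mul_ne_top ENNReal.ofReal_ne_top measure_ball_lt_top.ne) h1
    rwa [ENNReal.toReal_mul, ENNReal.toReal_ofReal (by positivity)] at h2
  have hc_eq : c * vC = (volume pre).toReal := by
    have h3 : ((volume pre).toReal : ℂ) = ((c * vC : ℝ) : ℂ) := by rw [h]; push_cast; ring
    exact (Complex.ofReal_injective h3).symm
  have hJR : jacobianRatio k d = vV / vC := rfl
  have hgoal : c * vC ≤ (L ^ Fintype.card (Fin (k + 2) × Fin d) * jacobianRatio k d) * vC := by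
    rw [hJR, hc_eq, mul_assoc, div_mul_cancel₀ _ hvol_cfg.ne']
    exact hvol_pre
  exact le_of_mul_le_mul_right hgoal hvol_cfg

/-- **Lower bound for the Jacobian constant**: `c ≥ ‖posLin‖^{-(k+2)d} · jacobianRatio` (the preimage
of the unit ball contains the ball of radius `‖posLin‖⁻¹`). [folklore] -/
theorem jacobian_ge {c : ℝ}
    (hc : ∀ Φ : (Fin (k + 2) → EuclideanSpace ℝ (Fin d)) → ℂ, ∫ U, Φ (posAff ξ ê hli U) = (c : ℂ) * ∫ y, Φ y) :
    (‖(posLinCLE (k := k) ê hli).toContinuousLinearMap‖⁻¹) ^ (Fintype.card (Fin (k + 2) × Fin d)) * jacobianRatio k d ≤ c := by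
  set Lf : ℝ := ‖(posLinCLE (k := k) ê hli).toContinuousLinearMap‖ with hLfdef
  have hLf : 0 < Lf := (posLinCLE (k := k) ê hli).norm_pos
  set L : ℝ := ‖((posLinCLE (k := k) ê hli).symm).toContinuousLinearMap‖ with hLdef
  have hL : 0 < L := (posLinCLE (k := k) ê hli).symm.norm_pos
  set pre : Set (EuclideanSpace ℝ (Fin (k + 2) × Fin d)) := (posAff ξ ê hli) ⁻¹' Metric.ball (pbase ξ) 1 with hpre
  have hpre_sup : Metric.ball 0 Lf⁻¹ ⊆ pre := fun U hU => by
    rw [mem_ball, dist_zero_right] at hU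
    rw [hpre, mem_preimage, mem_ball, dist_eq_norm, posAff, add_sub_cancel_left]
    calc ‖posLinCLE ê hli U‖ ≤ Lf * ‖U‖ := (posLinCLE ê hli).toContinuousLinearMap.le_opNorm U
      _ < Lf * Lf⁻¹ := mul_lt_mul_of_pos_left hU hLf
      _ = 1 := mul_inv_cancel₀ hLf.ne'
  have hpre_sub : pre ⊆ Metric.ball 0 L := fun U hU => by
    rw [hpre, mem_preimage, mem_ball, dist_eq_norm, posAff, add_sub_cancel_left] at hU
    rw [mem_ball, dist_zero_right]
    calc ‖U‖ = ‖(posLinCLE ê hli).symm (posLinCLE ê hli U)‖ := by rw [ContinuousLinearEquiv.symm_apply_apply]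
      _ ≤ L * ‖posLinCLE ê hli U‖ := ((posLinCLE ê hli).symm).toContinuousLinearMap.le_opNorm _
      _ < L := mul_lt_of_lt_one_right hL hU
  have hpre_fin : volume pre ≠ ∞ := (lt_of_le_of_lt (measure_mono hpre_sub) measure_ball_lt_top).ne
  have hpre_meas : MeasurableSet pre := (isOpen_ball.preimage (continuous_posAff ξ ê hli)).measurableSet
  have h := hc ((Metric.ball (pbase ξ) 1).indicator fun _ => (1 : ℂ))
  have hL1 : (fun U => (Metric.ball (pbase ξ) 1).indicator (fun _ => (1 : ℂ)) (posAff ξ ê hli U)) = pre.indicator fun _ => (1 : ℂ) := by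
    funext U; rfl
  rw [hL1, integral_indicator_const _ hpre_meas, integral_indicator_const _ measurableSet_ball] at h
  simp only [Measure.real, Complex.real_smul, mul_one] at h
  rw [Measure.addHaar_ball_center] at h
  set vV : ℝ := (volume (Metric.ball (0 : EuclideanSpace ℝ (Fin (k + 2) × Fin d)) 1)).toReal with hvV
  set vC : ℝ := (volume (Metric.ball (0 : Fin (k + 2) → EuclideanSpace ℝ (Fin d)) 1)).toReal with hvC
  have hvol_cfg : 0 < vC := ENNReal.toReal_pos (measure_ball_pos volume _ one_pos).ne' measure_ball_lt_top.ne
  have hvol_pre : Lf⁻¹ ^ Fintype.card (Fin (k + 2) × Fin d) * vV ≤ (volume pre).toReal := by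
    have h1 := measure_mono (μ := volume) hpre_sup
    rw [Measure.addHaar_ball_of_pos volume _ (inv_pos.2 hLf), finrank_euclideanSpace] at h1
    have h2 := ENNReal.toReal_mono hpre_fin h1
    rwa [ENNReal.toReal_mul, ENNReal.toReal_ofReal (by positivity)] at h2
  have hc_eq : c * vC = (volume pre).toReal := by
    have h3 : ((volume pre).toReal : ℂ) = ((c * vC : ℝ) : ℂ) := by rw [h]; push_cast; ring
    exact (Complex.ofReal_injective h3).symm
  have hJR : jacobianRatio k d = vV / vC := rfl
  have hgoal : (Lf⁻¹ ^ Fintype.card (Fin (k + 2) × Fin d) * jacobianRatio k d) * vC ≤ c * vC := by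
    rw [hJR, hc_eq, mul_assoc, div_mul_cancel₀ _ hvol_cfg.ne']
    exact hvol_pre
  exact le_of_mul_le_mul_right hgoal hvol_cfg

/-- The Jacobian constant lies between two positive constants depending on `k`, `d` and the frame
only: `((k+2) ∑‖ê_μ‖)^{-(k+2)d} jacobianRatio ≤ c`. [folklore] -/
theorem jacobian_ge' {c : ℝ}
    (hc : ∀ Φ : (Fin (k + 2) → EuclideanSpace ℝ (Fin d)) → ℂ, ∫ U, Φ (posAff ξ ê hli U) = (c : ℂ) * ∫ y, Φ y) :
    (((k + 2 : ℝ) * ∑ μ, ‖ê μ‖)⁻¹) ^ (Fintype.card (Fin (k + 2) × Fin d)) * jacobianRatio k d ≤ c := by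
  have hJR : 0 ≤ jacobianRatio k d := by unfold jacobianRatio; positivity
  refine le_trans (mul_le_mul_of_nonneg_right ?_ hJR) (jacobian_ge ξ ê hli hc)
  have hLf : 0 < ‖(posLinCLE (k := k) ê hli).toContinuousLinearMap‖ := (posLinCLE (k := k) ê hli).norm_pos
  exact pow_le_pow_left₀ (by positivity) ((inv_le_inv₀ (lt_of_lt_of_le hLf (opNorm_posLinCLE_le ê hli)) hLf).2
    (opNorm_posLinCLE_le ê hli)) _

end Jacobian

end Literature.MathematicalPhysics.QuantumFieldTheory
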